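import Literature.NumberTheory.EllipticCurves.EisensteinNewformLevelRaising
import Literature.NumberTheory.EllipticCurves.EisensteinNewformLevelRaisingDictionaryProofs
import Literature.NumberTheory.EllipticCurves.EisensteinSeriesNebentypusLevelRaised
import Literature.NumberTheory.EllipticCurves.EisensteinSeriesWeightTwoLevelRaised
import Literature.NumberTheory.EllipticCurves.HeckeEigenvectorModPOfCongruence
import Literature.NumberTheory.EllipticCurves.CuspFormCongruenceEigenformLiftProofs
import Literature.NumberTheory.EllipticCurves.PrimeLevelEigenpacketNewformProofs
import Literature.NumberTheory.ModularForms.TwistedDivisorSumsHecke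
import Literature.NumberTheory.EllipticCurves.ModularFormLevelRaisingProofs
import HarnessLib

/-!
# Billerey–Menares 2018, Thm. 2 (⟸) with Thm. 1: the proof, modulo its two analytic inputs

Topic `Literature/NumberTheory/EllipticCurves`; namespaces
`Literature.NumberTheory.EllipticCurves.ModularForms` (helpers, the abstract Steps 5–6) and
`Literature.NumberTheory.EllipticCurves` (the reduction theorem).  THEOREMS ONLY (no definition,
no named fact; D-0026).

`BillereyMenares2018_exists_newform` (`EisensteinNewformLevelRaising`) is Billerey–Menares'
Thm. 2 (⟸) together with Mazur's case `(N, k) = (1, 2)` (Thm. 1), for `χ₁ = 𝟙`, in the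
`ι : ℚ̄_p ≃ ℂ` language.  This file proves it from exactly the two inputs of the printed proof
(§3.2) that are not (yet) theorems of the tree, taken as hypotheses stated in the tree's
vocabulary:

* **(K) the cuspidal lift** — "the `q`-expansion principle allows us to ensure that `f` is a
  cuspidal form … there exists a weight-`k` cuspidal form of level `NM` and Nebentypus `χ`
  [lifting `F₂ mod 𝔭`]" (§3.2 with [Car89, §4.4] = Carayol's Lemma, Edixhoven 1997 Prop. 1.10,
  and Katz 1973 Cor. 1.6.2): a holomorphic `F ∈ M_k(Γ₁(L))`, `p ∤ L`, `p ≥ 5`, `k ≥ 2`, of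
  nebentypus `χ` (order prime to `p`, `χ(-1) = (-1)^k`) with `ℤ̄_p`-integral `q`-expansion at
  `i∞` and all constant terms `c_γ = lim (F ∣_k γ)` in `𝔪`, is congruent coefficientwise to some
  `G ∈ S_k(L, χ)`;
* **(E₂) the weight-`2` Eisenstein series `E_2^{𝟙,χ}`** for a non-trivial primitive even `χ`
  (§1.3, eq. (7.1.3), from [Miy06, Thm. 7.2.12 and Thm. 4.7.1]; its constant terms at all cusps:
  Prop. 4 with `M = 1`, `χ₁ = 𝟙`): `E ∈ M_2(Γ₁(N))` with `E ∣_2 γ = χ(d) E` on `Γ₀(N)`,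
  `a_n(E) = σ_1^χ(n)` (`n ≥ 1`) and `E ∣_2 γ → -(B_{2,χ}/4) χ(d) [N ∣ c]`.

Everything else is assembled from theorems of this directory, following §3.2 step by step:

0. `η̄ χ_p^{1-k} = χ̄ ∘ χ_N` with `χ` primitive mod `N`, `p ∤ N`, Teichmüller order, parity, and the
   Frobenius/inertia dictionary (`exists_dirichletCharacter_of_padicCharacter`);
3. `F₂ = E - E(M·)` on `Γ₁(NM)` with nebentypus `χ`, integral `q`-expansion
   `σ_{k-1}^χ(n) - [M ∣ n]σ_{k-1}^χ(n/M)` and all constant terms `≡ 0` when `χ(M)M^k ≡ 1`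
   (`EisensteinSeriesNebentypusLevelRaised` for `k ≥ 3`; `ModularFormLevelRaisingProofs` applied
   to (E₂) for `k = 2 < N`; Mazur's `E₂(z) - M E₂(Mz)`, `EisensteinSeriesWeightTwoLevelRaised`, for
   `(N, k) = (1, 2)`, where `η̄ = χ_p` forces `M ≡ 1 (mod p)`);
4. (K) gives `G ∈ S_k(NM, χ)` with `G ≡ F₂`;
5. `G` is a mod-`𝔪` eigenvector of `T_q` (`q ∤ NM`, eigenvalue `1 + χ(q)q^{k-1}`:
   `TwistedDivisorSumsHecke` + `valuation_cuspCoeff_heckeT_sub_lt_one`) and of `U_M`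
   (`levelRaised_heckeU`: eigenvalue `χ(M)M^{k-1}`, resp. `1` in Mazur's case), hence — Deligne–Serre
   6.11, `exists_eigenform_of_modP_eigenvector` — congruent to a genuine eigenform
   `g ∈ S_k(NM, χ)`;
6. `g` yields a newform `g₀` of level `N' ∈ {N, NM}` with the same `T_q`-eigenvalues, nebentypus
   `χ`, and, if `N' = N`, `μ² - a_M(g₀)μ + χ(M)M^{k-1} = 0` for the `U_M`-eigenvalue `μ`
   (`exists_isNewform1_of_eigenpacket_prime_level`);
8. reading off: `p ∤ N'`, `cond(χ) = N`, order of `χ` prime to `p`, `a_p(g₀) ≡ 1`,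
   `a_ℓ(g₀) ≡ 1 + η̄(Frob_ℓ)` and `χ(ℓ)ℓ^{k-1} ≡ η̄(Frob_ℓ)` for `ℓ ∤ N'p` (at `ℓ = M`, level `N`:
   from the quadratic relation, `μ ≡ χ(M)M^{k-1} ≡ η̄(Frob_M)`).

* `exists_newform_of_congruent_cuspForm` — Steps 5–6 for an abstract congruence `G ≡ b` with a
  formal Hecke eigenvector `b`.
* `BillereyMenares2018_exists_newform_of_cuspidalLift_of_weightTwoEisenstein` — (K), (E₂) ⊢
  `BillereyMenares2018_exists_newform`.

## References

* N. Billerey, R. Menares, *Strong modularity of reducible Galois representations*, Trans. Amer.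
  Math. Soc. 370 (2018), 967–986: Thm. 1, Thm. 2, §1.3, Prop. 4, §3.2. [BillereyMenares2018]
* H. Carayol, *Sur les représentations galoisiennes modulo ℓ attachées aux formes modulaires*,
  Duke Math. J. 59 (1989), §4.4. [Carayol1989]
* P. Deligne, J.-P. Serre, *Formes modulaires de poids 1*, Ann. Sci. ÉNS 7 (1974), Lemme 6.11.
  [DeligneSerreASENS1974]
* B. Mazur, *Modular curves and the Eisenstein ideal*, Publ. Math. IHÉS 47 (1977), Prop. II.5.12,
  Prop. II.9.7. [Mazur1977]
* T. Miyake, *Modular Forms*, Springer (1989/2006), Thm. 4.7.1, Thm. 7.2.12. [Miyake1989]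
-/

noncomputable section

open scoped MatrixGroups ModularForm Topology ArithmeticFunction.sigma
open CongruenceSubgroup UpperHalfPlane Filter
open Literature.NumberTheory.GaloisRepresentations Literature.NumberTheory.LFunctions

namespace Literature.NumberTheory.EllipticCurves.ModularForms

variable {p : ℕ} [Fact p.Prime]

/-! ### Small helpers -/

section Helpers

/-- `v(q) ≤ 1` for a natural number `q` in `ℚ̄_p`. [folklore] -/
private theorem v_natCast_le_one (q : ℕ) : Valued.v ((q : PadicAlgCl p)) ≤ 1 := by
  rw [PadicAlgCl.valuation_le_one_iff, ← map_natCast (algebraMap ℚ_[p] (PadicAlgCl p)),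
    PadicAlgCl.norm_extends]
  exact_mod_cast Padic.norm_int_le_one (q : ℤ)

/-- `v(ι⁻¹(q^(k-1))) ≤ 1` for `q ∈ ℕ`, `k ≥ 1`. [folklore] -/
private theorem v_symm_natCast_zpow_le_one (ι : PadicAlgCl p ≃+* ℂ) (q : ℕ) {k : ℤ} (hk : 1 ≤ k) :
    Valued.v (ι.symm ((q : ℂ) ^ (k - 1))) ≤ 1 := by
  rw [map_zpow₀, map_natCast, show k - 1 = (((k - 1).toNat : ℕ) : ℤ) by omega, zpow_natCast,
    Valuation.map_pow]
  exact pow_le_one₀ zero_le (v_natCast_le_one q)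

/-- A level-`N` character read at level `L`, `N ∣ L`, at a unit. [folklore] -/
theorem changeLevel_apply_intCast_of_isUnit {N L : ℕ} [NeZero L] (h : N ∣ L)
    (χ : DirichletCharacter ℂ N) {d : ℤ} (hd : IsUnit ((d : ZMod L))) :
    DirichletCharacter.changeLevel h χ (d : ZMod L) = χ (d : ZMod N) := by
  obtain ⟨u, hu⟩ := hd
  rw [← hu, DirichletCharacter.changeLevel_eq_cast_of_dvd χ h u, hu, ZMod.cast_intCast h]

/-- A level-`N` character read at level `L`, `N ∣ L`, at an integer prime to `L`. [folklore] -/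
theorem changeLevel_apply_natCast_of_coprime {N L : ℕ} [NeZero L] (h : N ∣ L)
    (χ : DirichletCharacter ℂ N) {q : ℕ} (hq : q.Coprime L) :
    DirichletCharacter.changeLevel h χ (q : ZMod L) = χ (q : ZMod N) := by
  have := DirichletCharacter.changeLevel_eq_cast_of_dvd' χ h (a := (q : ℤ))
    (Nat.isCoprime_iff_coprime.mpr hq)
  simpa only [Int.cast_natCast] using this

/-- `v(x) < 1 ↔ ‖x‖ < 1` on `ℚ̄_p`. [folklore] -/
private theorem v_lt_one_iff' (x : PadicAlgCl p) : Valued.v x < 1 ↔ ‖x‖ < 1 := by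
  rw [PadicAlgCl.valuation_def, ← NNReal.coe_lt_coe, coe_nnnorm, NNReal.coe_one]

/-- `v(n) < 1` for a natural number `n` divisible by `p`. [folklore] -/
private theorem v_natCast_lt_one_of_dvd {n : ℕ} (h : p ∣ n) : Valued.v ((n : PadicAlgCl p)) < 1 := by
  rw [v_lt_one_iff', ← map_natCast (algebraMap ℚ_[p] (PadicAlgCl p)), PadicAlgCl.norm_extends]
  exact Padic.norm_natCast_lt_one_iff.2 h

/-- `v(p) < 1`. [folklore] -/
private theorem v_natCast_p_lt_one : Valued.v ((p : PadicAlgCl p)) < 1 :=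
  v_natCast_lt_one_of_dvd dvd_rfl

/-- `a ≤ 1`, `b < 1` give `a * b < 1` in the value group. [folklore] -/
private theorem mul_lt_one_of_le_one_of_lt_one {a b : NNReal} (ha : a ≤ 1) (hb : b < 1) :
    a * b < 1 :=
  (mul_le_mul_left ha b).trans_lt (by rwa [one_mul])

end Helpers

/-! ### From a congruence with a formal eigenvector to a newform (Steps 5–6) -/

section Core

/-- **Steps 5–6 of Billerey–Menares §3.2 (⟸), abstract form.**  Let `χ` be primitive mod `N`,
`M ∤ N` a prime, `L = NM`, and `G ∈ S_k(Γ₁(L), χ)` (`k ≥ 1`) congruent modulo `𝔪` (through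
`ι : ℚ̄_p ≃ ℂ`) to a formal `q`-expansion `b` which is a `T_q`-eigenvector (`q ∤ L`, eigenvalue
`λ_q`, formal Hecke relation with nebentypus `χ`) and a `U_M`-eigenvector (`b_{Mn} = μ b_n`), with
`ι`-integral `b_n, λ_q, μ` and `b_1` a unit.  Then there is a newform `g₀` of level `N' ∈ {N, NM}`
with nebentypus `χ` (read at level `L`), `a_q(g₀) ≡ λ_q` for `q ∤ L`, and, when `N' = N`, a root
`μ' ≡ μ` of `X² - a_M(g₀)X + χ(M)M^{k-1}` (the `U_M`-eigenvalue on the old space).  Assembled from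
`valuation_cuspCoeff_heckeT_sub_lt_one` (mod-`𝔪` eigenvector), the Deligne–Serre lift
`exists_eigenform_of_modP_eigenvector` and `exists_isNewform1_of_eigenpacket_prime_level`.
[cite: BillereyMenares2018, §3.2 (proof of Thm. 2, ⟸: "By the Deligne–Serre lifting lemma … there exists a newform of weight k and level dividing NM")] -/
theorem exists_newform_of_congruent_cuspForm (ι : PadicAlgCl p ≃+* ℂ) {L N M : ℕ} [NeZero L]
    [NeZero N] [NeZero M] (hL : L = N * M) (hNL : N ∣ L) (hM : M.Prime) (hMN : ¬ M ∣ N) {k : ℤ}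
    (hk : 1 ≤ k) {χ : DirichletCharacter ℂ N} (hχ : χ.IsPrimitive) {G : CuspForm (Gamma1 L) k}
    (hGχ : G ∈ nebentypusSubspace L k (DirichletCharacter.changeLevel hNL χ))
    (b lamT : ℕ → ℂ) (μ : ℂ)
    (hbT : ∀ q : ℕ, q.Prime → ¬ q ∣ L → ∀ n, n ≠ 0 →
      b (q * n) + χ q * (q : ℂ) ^ (k - 1) * (if q ∣ n then b (n / q) else 0) = lamT q * b n)
    (hbU : ∀ n, n ≠ 0 → b (M * n) = μ * b n)
    (hlamT : ∀ q : ℕ, q.Prime → ¬ q ∣ L → Valued.v (ι.symm (lamT q)) ≤ 1)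
    (hμ : Valued.v (ι.symm μ) ≤ 1) (hbint : ∀ n, Valued.v (ι.symm (b n)) ≤ 1)
    (hb1 : Valued.v (ι.symm (b 1)) = 1)
    (hcong : ∀ n, Valued.v (ι.symm (cuspCoeff G n - b n)) < 1) :
    ∃ (N' : ℕ) (_ : NeZero N') (hN' : N' ∣ L) (g₀ : CuspForm (Gamma1 N') k), IsNewform1 g₀ ∧
      (N' = N ∨ N' = L) ∧
      DirichletCharacter.changeLevel hN' (nebentypus g₀) = DirichletCharacter.changeLevel hNL χ ∧
      (∀ q : ℕ, q.Prime → ¬ q ∣ L → Valued.v (ι.symm (cuspCoeff g₀ q)) ≤ 1 ∧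
        Valued.v (ι.symm (cuspCoeff g₀ q) - ι.symm (lamT q)) < 1) ∧
      (N' = N → ∃ μ' : ℂ, Valued.v (ι.symm μ') ≤ 1 ∧ Valued.v (ι.symm μ' - ι.symm μ) < 1 ∧
        μ' ^ 2 - cuspCoeff g₀ M * μ' + χ M * (M : ℂ) ^ (k - 1) = 0) := by
  classical
  subst hL
  have h1 := HeckeTGamma1.one_mem_strictPeriods_Gamma1 (N * M)
  set χL := DirichletCharacter.changeLevel hNL χ with hχL_def
  have hχLq : ∀ q : ℕ, q.Prime → ¬ q ∣ N * M → χL (q : ZMod (N * M)) = χ (q : ZMod N) :=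
    fun q hq hqL ↦ changeLevel_apply_natCast_of_coprime hNL χ
      ((Nat.Prime.coprime_iff_not_dvd hq).2 hqL)
  -- integrality of `G` and the unit coefficient `a_1(G)`
  have hGint : ∀ n, Valued.v (ι.symm (cuspCoeff G n)) ≤ 1 := fun n ↦ by
    have : cuspCoeff G n = (cuspCoeff G n - b n) + b n := by ring
    rw [this]
    exact (v_symm_add_le ι _ _).trans (max_le (hcong n).le (hbint n))
  have hm₀ : Valued.v (ι.symm (cuspCoeff G 1)) = 1 := by
    have : ι.symm (cuspCoeff G 1) = ι.symm (cuspCoeff G 1 - b 1) + ι.symm (b 1) := by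
      rw [← map_add, sub_add_cancel]
    rw [this, Valuation.map_add_eq_of_lt_right, hb1]
    rw [hb1]
    exact hcong 1
  have hcong' : ∀ n, Valued.v (ι.symm (b n - cuspCoeff G n)) < 1 := fun n ↦ by
    rw [← neg_sub, map_neg, Valuation.map_neg]; exact hcong n
  -- ### the primes `q ∤ NM` together with `M`, and the mod-`𝔪` eigenvalues
  set P : Set ℕ := {q | q.Prime ∧ (¬ q ∣ N * M ∨ q = M)} with hP_def
  have hP : ∀ q ∈ P, q.Prime := fun q hq ↦ hq.1
  set lam : ℕ → ℂ := fun q ↦ if q = M then μ else lamT q with hlam_def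
  have heig : ∀ (q : ℕ) (hq : q ∈ P) (n : ℕ),
      Valued.v (ι.symm (cuspCoeff
        (haveI : NeZero q := ⟨(hP q hq).ne_zero⟩; heckeT (Gamma1 (N * M)) k q G) n -
          lam q * cuspCoeff G n)) < 1 := by
    intro q hq n
    haveI : NeZero q := ⟨hq.1.ne_zero⟩
    by_cases hqM : q = M
    · -- `U_M`: `a_n(U_M G) = a_{Mn}(G) ≡ b_{Mn} = μ b_n ≡ μ a_n(G)`
      have hlamq : lam q = μ := if_pos hqM
      have hqL : q ∣ N * M := hqM ▸ dvd_mul_left M N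
      rw [hlamq, cuspCoeff_heckeT_gamma1 G q hq.1 n, if_pos hqL, add_zero]
      rcases Nat.eq_zero_or_pos n with rfl | hn
      · rw [mul_zero, cuspCoeff_zero h1, mul_zero, sub_zero, map_zero, Valuation.map_zero]
        exact zero_lt_one
      · have hbq : b (q * n) = μ * b n := by rw [hqM]; exact hbU n hn.ne'
        have : cuspCoeff G (q * n) - μ * cuspCoeff G n =
            (cuspCoeff G (q * n) - b (q * n)) + μ * (b n - cuspCoeff G n) := by rw [hbq]; ring
        rw [this]
        refine (v_symm_add_le ι _ _).trans_lt (max_lt (hcong _) ?_)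
        rw [map_mul, Valuation.map_mul]
        calc Valued.v (ι.symm μ) * Valued.v (ι.symm (b n - cuspCoeff G n))
            ≤ 1 * Valued.v (ι.symm (b n - cuspCoeff G n)) := mul_le_mul_left hμ _
          _ < 1 := by rw [one_mul]; exact hcong' n
    · -- `T_q`, `q ∤ NM`: the mod-`𝔪` eigenvector lemma
      have hqL : ¬ q ∣ N * M := by
        rcases hq.2 with h | h
        · exact h
        · exact absurd h hqM
      have hlamq : lam q = lamT q := if_neg hqM
      rw [hlamq]
      refine valuation_cuspCoeff_heckeT_sub_lt_one ι hGχ hq.1 hqL b (lamT q) ?_ ?_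
        (hlamT q hq.1 hqL) (fun n _ ↦ hcong n) n
      · intro n hn
        rw [hχLq q hq.1 hqL]
        exact hbT q hq.1 hqL n hn
      · rw [hχLq q hq.1 hqL, map_mul, Valuation.map_mul]
        exact mul_le_one' (v_symm_dirichletCharacter_le_one ι χ _)
          (v_symm_natCast_zpow_le_one ι q hk)
  -- ### Step 5: the Deligne–Serre lift
  obtain ⟨g, α, hg0, hgχ, hgeig⟩ :=
    exists_eigenform_of_modP_eigenvector ι hk χL P hP lam hGχ hGint 1 hm₀ heig
  -- ### Step 6: the newform and its level
  have hT : ∀ (q : ℕ) (hq : q.Prime), ¬ q ∣ N * M →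
      (haveI : NeZero q := ⟨hq.ne_zero⟩; heckeT (Gamma1 (N * M)) k q g) = α q • g :=
    fun q hq hqL ↦ (hgeig q ⟨hq, Or.inl hqL⟩).1
  have hU : heckeT (Gamma1 (N * M)) k M g = α M • g := (hgeig M ⟨hM, Or.inr rfl⟩).1
  obtain ⟨N', _, hN', g₀, hnew, hN'eq, hcoef, hquad, hneb⟩ :=
    exists_isNewform1_of_eigenpacket_prime_level hM hMN hχ hg0 hgχ hT hU
  refine ⟨N', ‹_›, hN', g₀, hnew, hN'eq, hneb, fun q hq hqL ↦ ?_, fun hN'N ↦ ?_⟩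
  · obtain ⟨-, hle, hlt⟩ := hgeig q ⟨hq, Or.inl hqL⟩
    have hqM : q ≠ M := fun h ↦ hqL (h ▸ dvd_mul_left M N)
    have hlamq : lam q = lamT q := if_neg hqM
    rw [hcoef q hq hqL, ← hlamq]
    exact ⟨hle, hlt⟩
  · obtain ⟨-, hle, hlt⟩ := hgeig M ⟨hM, Or.inr rfl⟩
    have hlamM : lam M = μ := if_pos rfl
    rw [hlamM] at hlt
    exact ⟨α M, hle, hlt, hquad hN'N⟩

end Core

end Literature.NumberTheory.EllipticCurves.ModularForms

/-! ### The reduction theorem -/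

namespace Literature.NumberTheory.EllipticCurves

open Literature.NumberTheory.EllipticCurves.ModularForms Literature.NumberTheory.ModularForms
open NumberField IsDedekindDomain Field

variable {p : ℕ} [Fact p.Prime]

set_option maxHeartbeats 800000 in
/-- **Billerey–Menares 2018, Thm. 2 (⟸) with Thm. 1, reduced to its two analytic inputs.**
`BillereyMenares2018_exists_newform` holds as soon as
(K) *the cuspidal lift* (Katz's `q`-expansion principle with Carayol's Lemma, as used in §3.2:
  a holomorphic form of level `L`, `p ∤ L`, weight `k ≥ 2`, nebentypus `χ` of order prime to `p`,
  with `ℤ̄_p`-integral `q`-expansion and all constant terms in `𝔪`, is congruent to a cusp form in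
  `S_k(L, χ)`), and
(E₂) *the weight-`2` Eisenstein series `E_2^{𝟙,χ}`* for a non-trivial primitive even `χ`
  (§1.3, eq. (7.1.3) via [Miy06, Thm. 7.2.12 and Thm. 4.7.1]; constant terms: Prop. 4 with `M = 1`)
are available; every other step of the printed proof is a theorem of this directory.
[cite: BillereyMenares2018, Thm. 1, Thm. 2 and §3.2; Prop. 4; §1.3] -/
theorem BillereyMenares2018_exists_newform_of_cuspidalLift_of_weightTwoEisenstein
    (hK : ∀ (p : ℕ) [Fact p.Prime], 5 ≤ p → ∀ (ι : PadicAlgCl p ≃+* ℂ) (L : ℕ) [NeZero L],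
      ¬ p ∣ L → ∀ (k : ℤ), 2 ≤ k → ∀ (χ : DirichletCharacter ℂ L) (F : ModularForm (Gamma1 L) k),
        χ (-1) = (-1) ^ k → (∃ m : ℕ, 0 < m ∧ ¬ p ∣ m ∧ χ ^ m = 1) →
        (∀ γ : SL(2, ℤ), γ ∈ Gamma0 L →
          (⇑F : ℍ → ℂ) ∣[k] γ = χ ((γ 1 1 : ℤ) : ZMod L) • (⇑F : ℍ → ℂ)) →
        (∀ n : ℕ, Valued.v (ι.symm ((qExpansion 1 ⇑F).coeff n)) ≤ 1) →
        (∀ γ : SL(2, ℤ), ∃ c : ℂ,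
          Tendsto ((⇑F : ℍ → ℂ) ∣[k] γ) atImInfty (𝓝 c) ∧ Valued.v (ι.symm c) < 1) →
        ∃ G : CuspForm (Gamma1 L) k, G ∈ nebentypusSubspace L k χ ∧
          ∀ n : ℕ, Valued.v (ι.symm ((qExpansion 1 ⇑G).coeff n - (qExpansion 1 ⇑F).coeff n)) < 1)
    (hE2 : ∀ (N : ℕ) [NeZero N] (χ : DirichletCharacter ℂ N), χ.IsPrimitive → N ≠ 1 →
      χ (-1) = 1 →
      ∃ E : ModularForm (Gamma1 N) 2,
        (∀ γ : SL(2, ℤ), γ ∈ Gamma0 N →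
          (⇑E : ℍ → ℂ) ∣[(2 : ℤ)] γ = χ ((γ 1 1 : ℤ) : ZMod N) • (⇑E : ℍ → ℂ)) ∧
        (∀ n : ℕ, n ≠ 0 → (qExpansion 1 ⇑E).coeff n = ∑ d ∈ n.divisors, χ d * (d : ℂ)) ∧
        (∀ γ : SL(2, ℤ), Tendsto ((⇑E : ℍ → ℂ) ∣[(2 : ℤ)] γ) atImInfty
          (𝓝 (if ((γ 1 0 : ℤ) : ZMod N) = 0 then
            -(generalizedBernoulli 2 χ) / 4 * χ ((γ 1 1 : ℤ) : ZMod N) else 0)))) :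
    BillereyMenares2018_exists_newform := by
  intro p _ hp5 ι θ k M hunit hodd hk2 hkp hIp hM hMp hIM hFrobM hMazur
  classical
  have hp : p.Prime := Fact.out
  have hp3 : 3 ≤ p := by omega
  haveI : NeZero M := ⟨hM.ne_zero⟩
  -- ### Step 0: the Dirichlet character `χ` of `η̄ χ_p^{1-k}` and the Galois-side bookkeeping
  have hpw := natCast_mem_asIdeal_primesEquiv_symm p hp
  obtain ⟨N, _, χ, hχ, hpN, hpar, horder, hcongτ, hFrobℓ, hMclause⟩ :=
    exists_dirichletCharacter_of_padicCharacter hp3 ι θ (k := k) (by omega) hunit hodd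
      ⟨_, hpw, hIp _ hpw⟩
  obtain ⟨hMN, hMcong⟩ := hMclause M hM hMp hIM
  have hχM : Valued.v (ι.symm ((χ (M : ZMod N) : ℂ) * (M : ℂ) ^ (k : ℤ)) - 1) < 1 := hMcong hFrobM
  have hpNM : ¬ p ∣ N * M := by
    intro h
    rcases (Nat.Prime.dvd_mul hp).1 h with h | h
    · exact hpN h
    · exact hMp ((Nat.prime_dvd_prime_iff_eq hp hM).1 h).symm
  have hMcop : M.Coprime N := (Nat.Prime.coprime_iff_not_dvd hM).2 hMN
  have hzpow : ∀ q : ℕ, (q : ℂ) ^ ((k : ℤ) - 1) = (q : ℂ) ^ (k - 1) := fun q ↦ by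
    rw [show ((k : ℤ) - 1) = ((k - 1 : ℕ) : ℤ) by omega, zpow_natCast]
  -- ### Steps 3–4: a cusp form `G ∈ S_k(Γ₁(L), χ)`, `L = NM`, congruent to the level-raised
  -- Eisenstein series, packaged with its formal Hecke eigenvalues
  obtain ⟨L, _, hL, hNL, G, b, μ, hGχ, hbT, hbU, hμ, hbint, hb1, hcong, hμFrob⟩ :
      ∃ (L : ℕ) (_ : NeZero L) (_ : L = N * M) (hNL : N ∣ L) (G : CuspForm (Gamma1 L) k)
        (b : ℕ → ℂ) (μ : ℂ),
        G ∈ nebentypusSubspace L k (DirichletCharacter.changeLevel hNL χ) ∧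
        (∀ q : ℕ, q.Prime → ¬ q ∣ L → ∀ n, n ≠ 0 →
          b (q * n) + χ q * (q : ℂ) ^ ((k : ℤ) - 1) * (if q ∣ n then b (n / q) else 0) =
            (1 + χ q * (q : ℂ) ^ ((k : ℤ) - 1)) * b n) ∧
        (∀ n, n ≠ 0 → b (M * n) = μ * b n) ∧
        Valued.v (ι.symm μ) ≤ 1 ∧ (∀ n, Valued.v (ι.symm (b n)) ≤ 1) ∧
        Valued.v (ι.symm (b 1)) = 1 ∧
        (∀ n, Valued.v (ι.symm (cuspCoeff G n - b n)) < 1) ∧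
        (∀ w : HeightOneSpectrum (𝓞 ℚ), (M : 𝓞 ℚ) ∈ w.asIdeal → ∀ 𝔓 ∈ w.primesAbove,
          ∀ s : absoluteGaloisGroup ℚ, IsArithFrobAt (𝓞 ℚ) s 𝔓 →
            Valued.v (ι.symm μ - ((θ s : (PadicAlgCl p)ˣ) : PadicAlgCl p)) < 1) := by
    by_cases hk3 : 3 ≤ k
    · -- ## `k ≥ 3`: `F₂ = E_k^{𝟙,χ} - E_k^{𝟙,χ}(M·)` (`EisensteinSeriesNebentypusLevelRaised`)
      have hkp' : k < p - 1 := by omega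
      have hNL : N ∣ N * M := dvd_mul_right N M
      set F₂ := eisensteinLevelRaised N k χ M hk3 with hF₂_def
      set χL := DirichletCharacter.changeLevel hNL χ with hχL_def
      have hχLunit : ∀ {d : ℤ}, IsUnit ((d : ZMod (N * M))) →
          χL (d : ZMod (N * M)) = χ (d : ZMod N) :=
        fun hd ↦ changeLevel_apply_intCast_of_isUnit hNL χ hd
      have hparL : χL (-1) = (-1) ^ (k : ℤ) := by
        have h := hχLunit (d := -1) (by rw [Int.cast_neg, Int.cast_one]; exact isUnit_one.neg)
        rw [Int.cast_neg, Int.cast_one, Int.cast_neg, Int.cast_one] at h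
        rw [h, hpar, zpow_natCast]
      have horderL : ∃ m : ℕ, 0 < m ∧ ¬ p ∣ m ∧ χL ^ m = 1 := by
        obtain ⟨m, hm0, hpm, hχm⟩ := horder
        exact ⟨m, hm0, hpm, by rw [hχL_def, ← map_pow, hχm, map_one]⟩
      have hslash : ∀ γ : SL(2, ℤ), γ ∈ Gamma0 (N * M) →
          (⇑F₂ : ℍ → ℂ) ∣[((k : ℕ) : ℤ)] γ = χL ((γ 1 1 : ℤ) : ZMod (N * M)) • (⇑F₂ : ℍ → ℂ) := by
        intro γ hγ
        rw [eisensteinLevelRaised_slash_of_mem_gamma0 k χ M hk3 hγ,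
          hχLunit (isUnit_entry_of_mem_gamma0 (N * M) hγ)]
      have hint : ∀ n, Valued.v (ι.symm ((qExpansion 1 ⇑F₂).coeff n)) ≤ 1 :=
        valuation_qExpansion_coeff_eisensteinLevelRaised_le_one k χ M ι hk3 hχ hpar hpN hkp'
      have hcusps : ∀ γ : SL(2, ℤ), ∃ c : ℂ,
          Tendsto ((⇑F₂ : ℍ → ℂ) ∣[((k : ℕ) : ℤ)] γ) atImInfty (𝓝 c) ∧ Valued.v (ι.symm c) < 1 :=
        exists_tendsto_eisensteinLevelRaised_slash_valuation_lt_one k χ M ι hk3 hpN hkp' hM hMp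
          hMcop hχM
      obtain ⟨G, hGχ, hGcong⟩ := hK p hp5 ι (N * M) hpNM (k : ℤ) (by omega) χL F₂ hparL horderL
        hslash hint hcusps
      have hcoefF : ∀ n, n ≠ 0 → (qExpansion 1 ⇑F₂).coeff n =
          (∑ d ∈ n.divisors, χ d * (d : ℂ) ^ (k - 1)) -
            (if M ∣ n then ∑ d ∈ (n / M).divisors, χ d * (d : ℂ) ^ (k - 1) else 0) := fun n hn ↦ by
        rw [hF₂_def, qExpansion_coeff_eisensteinLevelRaised k χ M hk3 hχ hpar, if_neg hn]
      refine ⟨N * M, inferInstance, rfl, hNL, G, fun n ↦ (qExpansion 1 ⇑F₂).coeff n,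
        χ M * (M : ℂ) ^ ((k : ℤ) - 1), hGχ, ?_, ?_, ?_, hint, ?_, hGcong, hFrobℓ M hM hMN hMp⟩
      · -- `T_q`, `q ∤ NM` (brick `levelRaised_hecke`)
        intro q hq hqL n hn
        dsimp only
        have hqM : ¬ q ∣ M := fun h ↦ hqL (h.trans (dvd_mul_left M N))
        have hqn : q * n ≠ 0 := mul_ne_zero hq.ne_zero hn
        have key := levelRaised_hecke χ (k - 1) hq hqM (NeZero.ne M) hn
        rw [hzpow q, hcoefF _ hqn, hcoefF _ hn]
        by_cases hqd : q ∣ n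
        · have hnq : n / q ≠ 0 := by
            obtain ⟨c, rfl⟩ := hqd
            rw [Nat.mul_div_cancel_left _ hq.pos]
            rintro rfl
            exact hn (mul_zero q)
          rw [if_pos hqd, hcoefF _ hnq]
          rw [if_pos hqd] at key
          linear_combination key
        · rw [if_neg hqd]
          rw [if_neg hqd] at key
          linear_combination key
      · -- `U_M` (brick `levelRaised_heckeU`)
        intro n hn
        dsimp only
        have hMn : M * n ≠ 0 := mul_ne_zero (NeZero.ne M) hn
        rw [hcoefF _ hMn, hcoefF _ hn, hzpow M]
        exact levelRaised_heckeU χ (k - 1) hM hn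
      · rw [map_mul, Valuation.map_mul]
        exact mul_le_one' (v_symm_dirichletCharacter_le_one ι χ _)
          (v_symm_natCast_zpow_le_one ι M (by omega))
      · dsimp only
        rw [hcoefF 1 one_ne_zero, if_neg hM.not_dvd_one, Nat.divisors_one, Finset.sum_singleton]
        simp only [Nat.cast_one, map_one, one_pow, mul_one, sub_zero]
    · obtain rfl : k = 2 := by omega
      by_cases hN1 : N = 1
      · -- ## `(N, k) = (1, 2)`: Mazur's `E₂(z) - M E₂(Mz)` (`EisensteinSeriesWeightTwoLevelRaised`)
        subst hN1
        obtain rfl : χ = 1 := DirichletCharacter.level_one χ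
        have h11 : ∀ x : ZMod 1, (1 : DirichletCharacter ℂ 1) x = 1 := fun x ↦
          MulChar.one_apply (isUnit_of_subsingleton x)
        -- `η̄ = χ_p`, hence `M ≡ 1 (mod p)`
        have hpM1 : p ∣ M - 1 := by
          have hmod : M % p = 1 := by
            refine hMazur fun τ ↦ ?_
            have h := hcongτ τ
            rw [h11, map_one, one_mul, show (2 : ℕ) - 1 = 1 from rfl, pow_one,
              Valuation.map_sub_swap] at h
            exact h
          exact (Nat.modEq_iff_dvd' hM.one_lt.le).1
            (by rw [Nat.ModEq, Nat.mod_eq_of_lt hp.one_lt, hmod])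
        have hpM : ¬ p ∣ M := fun h ↦ hMp ((Nat.prime_dvd_prime_iff_eq hp hM).1 h).symm
        obtain ⟨G, hGχ, hGcong⟩ := hK p hp5 ι M hpM ((2 : ℕ) : ℤ) (by norm_num)
          (1 : DirichletCharacter ℂ M) (mazurEisensteinMF M hM)
          (by rw [MulChar.one_apply isUnit_one.neg, zpow_natCast]; norm_num)
          ⟨1, one_pos, hp.not_dvd_one, one_pow 1⟩
          (fun γ hγ ↦ mazurEisensteinMF_slash_eq_one_apply_smul M hM hγ)
          (valuation_qExpansion_coeff_mazurEisensteinMF_le_one M ι hM)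
          (exists_tendsto_mazurEisensteinMF_slash_valuation_lt_one M ι hM hpM1)
        -- the coefficients `b_n = -24 (σ₁(n) - M [M ∣ n] σ₁(n/M))`
        have hσ : ∀ n, (σ 1 n : ℂ) = ∑ d ∈ n.divisors, (1 : DirichletCharacter ℂ 1) d * (d : ℂ) ^ 1 :=
          fun n ↦ by simp [ArithmeticFunction.sigma_apply, h11]
        have hcoefF : ∀ n, n ≠ 0 → (qExpansion 1 ⇑(mazurEisensteinMF M hM)).coeff n =
            -24 * ((∑ d ∈ n.divisors, (1 : DirichletCharacter ℂ 1) d * (d : ℂ) ^ 1) -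
              (M : ℂ) * (if M ∣ n then
                ∑ d ∈ (n / M).divisors, (1 : DirichletCharacter ℂ 1) d * (d : ℂ) ^ 1 else 0)) := by
          intro n hn
          rw [qExpansion_coeff_mazurEisensteinMF M hM n, if_neg hn, hσ]
          split_ifs <;> simp [hσ]
        have h2 : (((2 : ℕ) : ℤ) - 1) = 1 := by norm_num
        refine ⟨M, inferInstance, (one_mul M).symm, one_dvd M, G,
          fun n ↦ (qExpansion 1 ⇑(mazurEisensteinMF M hM)).coeff n, 1, ?_, ?_, ?_, ?_,
          valuation_qExpansion_coeff_mazurEisensteinMF_le_one M ι hM, ?_, hGcong, ?_⟩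
        · rwa [DirichletCharacter.changeLevel_one]
        · -- `T_q`, `q ≠ M` (brick `levelRaised_hecke_const` with `C = M`)
          intro q hq hqM n hn
          dsimp only
          have hqn : q * n ≠ 0 := mul_ne_zero hq.ne_zero hn
          have key := levelRaised_hecke_const (1 : DirichletCharacter ℂ 1) 1 (M : ℂ) hq hqM
            (NeZero.ne M) hn
          rw [h11, h2, zpow_one, hcoefF _ hqn, hcoefF _ hn]
          rw [h11, pow_one] at key
          by_cases hqd : q ∣ n
          · have hnq : n / q ≠ 0 := by
              obtain ⟨c, rfl⟩ := hqd
              rw [Nat.mul_div_cancel_left _ hq.pos]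
              rintro rfl
              exact hn (mul_zero q)
            rw [if_pos hqd, hcoefF _ hnq]
            rw [if_pos hqd] at key
            linear_combination (-24 : ℂ) * key
          · rw [if_neg hqd]
            rw [if_neg hqd] at key
            linear_combination (-24 : ℂ) * key
        · -- `U_M = 1` (brick `levelRaised_const_heckeU`)
          intro n hn
          dsimp only
          have hMn : M * n ≠ 0 := mul_ne_zero (NeZero.ne M) hn
          have key := levelRaised_const_heckeU (1 : DirichletCharacter ℂ 1) 1 hM hn
          rw [h11, pow_one, one_mul] at key
          rw [hcoefF _ hMn, hcoefF _ hn, one_mul]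
          linear_combination (-24 : ℂ) * key
        · rw [map_one, Valuation.map_one]
        · -- `b_1 = -24` is a `p`-adic unit (`p ≥ 5`)
          have h24 : ¬ p ∣ 24 := by
            intro h
            have h' : p ∣ 2 ^ 3 * 3 := by norm_num; exact h
            rcases (Nat.Prime.dvd_mul hp).1 h' with h2' | h3
            · have := (Nat.prime_dvd_prime_iff_eq hp Nat.prime_two).1 (hp.dvd_of_dvd_pow h2')
              omega
            · have := (Nat.prime_dvd_prime_iff_eq hp Nat.prime_three).1 h3
              omega
          dsimp only
          rw [hcoefF 1 one_ne_zero, if_neg hM.not_dvd_one, Nat.divisors_one, Finset.sum_singleton]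
          simp only [Nat.cast_one, h11, one_pow, mul_one, mul_zero, sub_zero, map_neg,
            Valuation.map_neg]
          rw [map_ofNat, PadicAlgCl.valuation_eq_one_iff, show (24 : PadicAlgCl p) = ((24 : ℕ) : PadicAlgCl p)
            from (Nat.cast_ofNat).symm]
          exact PadicAlgCl.norm_natCast_of_not_dvd h24
        · -- `μ = 1 ≡ M ≡ η(Frob_M)`
          intro w hw 𝔓 h𝔓 σ' hσ'
          have h := hFrobℓ M hM hM.not_dvd_one hMp w hw 𝔓 h𝔓 σ' hσ'
          rw [h11, one_mul, h2, zpow_one, map_natCast] at h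
          set e := ((θ σ' : (PadicAlgCl p)ˣ) : PadicAlgCl p) with he
          have h1M : Valued.v ((1 : PadicAlgCl p) - M) < 1 := by
            rw [Valuation.map_sub_swap, show (M : PadicAlgCl p) - 1 = ((M - 1 : ℕ) : PadicAlgCl p) by
              rw [Nat.cast_sub hM.one_lt.le, Nat.cast_one]]
            exact v_natCast_lt_one_of_dvd hpM1
          rw [map_one, show (1 : PadicAlgCl p) - e = ((1 : PadicAlgCl p) - M) + ((M : PadicAlgCl p) - e)
            by ring]
          exact (Valuation.map_add _ _ _).trans_lt (max_lt h1M h)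
      · -- ## `k = 2`, `N > 1`: `F₂ = E_2^{𝟙,χ} - E_2^{𝟙,χ}(M·)` from the input `E_2^{𝟙,χ}`
        -- (`ModularFormLevelRaisingProofs`)
        have hNL : N ∣ N * M := dvd_mul_right N M
        have hpar1 : χ (-1) = 1 := by rw [hpar]; norm_num
        obtain ⟨E, hEslash, hEcoef, hEcusp⟩ := hE2 N χ hχ hN1 hpar1
        obtain ⟨F₂, hF₂coe, hF₂coef⟩ := exists_levelRaised_modularForm M E
        set χL := DirichletCharacter.changeLevel hNL χ with hχL_def
        have hχLunit : ∀ {d : ℤ}, IsUnit ((d : ZMod (N * M))) →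
            χL (d : ZMod (N * M)) = χ (d : ZMod N) :=
          fun hd ↦ changeLevel_apply_intCast_of_isUnit hNL χ hd
        have hparL : χL (-1) = (-1) ^ (2 : ℤ) := by
          have h := hχLunit (d := -1) (by rw [Int.cast_neg, Int.cast_one]; exact isUnit_one.neg)
          rw [Int.cast_neg, Int.cast_one, Int.cast_neg, Int.cast_one] at h
          rw [h, hpar1]; norm_num
        have horderL : ∃ m : ℕ, 0 < m ∧ ¬ p ∣ m ∧ χL ^ m = 1 := by
          obtain ⟨m, hm0, hpm, hχm⟩ := horder
          exact ⟨m, hm0, hpm, by rw [hχL_def, ← map_pow, hχm, map_one]⟩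
        have hslash : ∀ γ : SL(2, ℤ), γ ∈ Gamma0 (N * M) →
            (⇑F₂ : ℍ → ℂ) ∣[(2 : ℤ)] γ = χL ((γ 1 1 : ℤ) : ZMod (N * M)) • (⇑F₂ : ℍ → ℂ) := by
          intro γ hγ
          rw [hF₂coe, levelRaise_slash_of_mem_gamma0 χ M hEslash hγ,
            hχLunit (isUnit_entry_of_mem_gamma0 (N * M) hγ)]
        -- integrality of the coefficients `σ_1^χ(n) - [M ∣ n] σ_1^χ(n/M)`
        have hEint : ∀ n, n ≠ 0 → Valued.v (ι.symm ((qExpansion 1 ⇑E).coeff n)) ≤ 1 := by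
          intro n hn
          rw [hEcoef n hn, map_sum]
          refine Valuation.map_sum_le _ fun d _ ↦ ?_
          rw [map_mul, Valuation.map_mul, map_natCast ι.symm]
          exact mul_le_one' (v_symm_dirichletCharacter_le_one ι χ _) (v_natCast_le_one d)
        have hint : ∀ n, Valued.v (ι.symm ((qExpansion 1 ⇑F₂).coeff n)) ≤ 1 := by
          intro n
          rw [hF₂coef]
          rcases Nat.eq_zero_or_pos n with rfl | hn
          · rw [if_pos (dvd_zero M), Nat.zero_div, sub_self, map_zero, Valuation.map_zero]
            exact zero_le
          · rw [map_sub]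
            refine (Valuation.map_sub _ _ _).trans (max_le (hEint n hn.ne') ?_)
            split_ifs with hMn
            · refine hEint _ ?_
              obtain ⟨c, rfl⟩ := hMn
              rw [Nat.mul_div_cancel_left _ (NeZero.pos M)]
              rintro rfl
              exact hn.ne' (mul_zero M)
            · rw [map_zero, Valuation.map_zero]; exact zero_le
        -- integrality of `A = -B_{2,χ}/4` (`p ∤ N`, `2 < p - 1`)
        set A : ℂ := -(generalizedBernoulli 2 χ) / 4 with hA_def
        have hAint : Valued.v (ι.symm A) ≤ 1 := by
          set S : Subring ℂ :=
            ((Valued.v (R := PadicAlgCl p)).valuationSubring.toSubring).comap ι.symm.toRingHom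
            with hS
          have hmem : ∀ x : ℂ, x ∈ S ↔ Valued.v (ι.symm x) ≤ 1 := fun x ↦ by
            simp [hS, Valuation.mem_valuationSubring_iff]
          have hχS : ∀ j, χ j ∈ S := fun j ↦
            (hmem _).2 (valuation_ringEquiv_symm_apply_le_one χ ι j)
          have hratS : ∀ q : ℚ, Rat.padicValuation p q ≤ 1 → algebraMap ℚ ℂ q ∈ S :=
            fun q hq ↦ (hmem _).2 (valuation_ringEquiv_symm_ratCast_le_one ι hq)
          have hB : generalizedBernoulli 2 χ ∈ S :=
            generalizedBernoulli_mem_subring χ S hχS hratS hpN (by omega)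
          have hq : Rat.padicValuation p (-(1 / 4) : ℚ) ≤ 1 := by
            have h4 : ¬ p ∣ 4 := fun h ↦ by
              have := Nat.le_of_dvd (by norm_num) h
              omega
            rw [Valuation.map_neg, map_div₀, map_one,
              show ((4 : ℚ)) = ((4 : ℕ) : ℚ) by norm_num, padicValuation_natCast_eq_one h4,
              div_one]
          have hcoef : A ∈ S := by
            have h := Subring.mul_mem S hB (hratS _ hq)
            convert h using 1
            rw [map_neg, map_div₀, map_one, map_ofNat, hA_def]
            ring
          exact (hmem A).1 hcoef
        have hχM' : Valued.v (ι.symm ((χ (M : ZMod N) : ℂ) * (M : ℂ) ^ (2 : ℤ)) - 1) < 1 := by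
          exact_mod_cast hχM
        have hcusps : ∀ γ : SL(2, ℤ), ∃ c : ℂ,
            Tendsto ((⇑F₂ : ℍ → ℂ) ∣[(2 : ℤ)] γ) atImInfty (𝓝 c) ∧ Valued.v (ι.symm c) < 1 := by
          intro γ
          rw [hF₂coe]
          exact exists_tendsto_levelRaise_slash_valuation_lt_one χ M ι hEcusp hAint hM hMp hMcop
            hχM' γ
        obtain ⟨G, hGχ, hGcong⟩ := hK p hp5 ι (N * M) hpNM (2 : ℤ) le_rfl χL F₂ hparL horderL
          hslash hint hcusps
        -- the coefficients `b_n = σ_1^χ(n) - [M ∣ n] σ_1^χ(n/M)`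
        have hcoefF : ∀ n, n ≠ 0 → (qExpansion 1 ⇑F₂).coeff n =
            (∑ d ∈ n.divisors, χ d * (d : ℂ)) -
              (if M ∣ n then ∑ d ∈ (n / M).divisors, χ d * (d : ℂ) else 0) := by
          intro n hn
          rw [hF₂coef, hEcoef n hn]
          by_cases hMn : M ∣ n
          · have hnM : n / M ≠ 0 := by
              obtain ⟨c, rfl⟩ := hMn
              rw [Nat.mul_div_cancel_left _ (NeZero.pos M)]
              rintro rfl
              exact hn (mul_zero M)
            rw [if_pos hMn, if_pos hMn, hEcoef _ hnM]
          · rw [if_neg hMn, if_neg hMn]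
        have h2 : (((2 : ℕ) : ℤ) - 1) = 1 := by norm_num
        refine ⟨N * M, inferInstance, rfl, hNL, G, fun n ↦ (qExpansion 1 ⇑F₂).coeff n,
          χ M * (M : ℂ) ^ (((2 : ℕ) : ℤ) - 1), hGχ, ?_, ?_, ?_, hint, ?_, hGcong,
          hFrobℓ M hM hMN hMp⟩
        · -- `T_q`, `q ∤ NM` (brick `levelRaised_hecke`, `j = 1`)
          intro q hq hqL n hn
          dsimp only
          have hqM : ¬ q ∣ M := fun h ↦ hqL (h.trans (dvd_mul_left M N))
          have hqn : q * n ≠ 0 := mul_ne_zero hq.ne_zero hn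
          have key := levelRaised_hecke χ 1 hq hqM (NeZero.ne M) hn
          simp only [pow_one] at key
          rw [h2, zpow_one, hcoefF _ hqn, hcoefF _ hn]
          by_cases hqd : q ∣ n
          · have hnq : n / q ≠ 0 := by
              obtain ⟨c, rfl⟩ := hqd
              rw [Nat.mul_div_cancel_left _ hq.pos]
              rintro rfl
              exact hn (mul_zero q)
            rw [if_pos hqd, hcoefF _ hnq]
            rw [if_pos hqd] at key
            linear_combination key
          · rw [if_neg hqd]
            rw [if_neg hqd] at key
            linear_combination key
        · -- `U_M` (brick `levelRaised_heckeU`, `j = 1`)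
          intro n hn
          dsimp only
          have hMn : M * n ≠ 0 := mul_ne_zero (NeZero.ne M) hn
          have key := levelRaised_heckeU χ 1 hM hn
          simp only [pow_one] at key
          rw [hcoefF _ hMn, hcoefF _ hn, h2, zpow_one]
          exact key
        · rw [map_mul, Valuation.map_mul]
          exact mul_le_one' (v_symm_dirichletCharacter_le_one ι χ _)
            (v_symm_natCast_zpow_le_one ι M (by norm_num))
        · dsimp only
          rw [hcoefF 1 one_ne_zero, if_neg hM.not_dvd_one, Nat.divisors_one, Finset.sum_singleton]
          simp only [Nat.cast_one, map_one, mul_one, sub_zero]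
  -- ### Steps 5–6: the newform
  have hlamT : ∀ q : ℕ, q.Prime → ¬ q ∣ L →
      Valued.v (ι.symm (1 + χ q * (q : ℂ) ^ ((k : ℤ) - 1))) ≤ 1 := by
    intro q _ _
    refine (v_symm_add_le ι _ _).trans (max_le ?_ ?_)
    · rw [map_one, Valuation.map_one]
    · rw [map_mul, Valuation.map_mul]
      exact mul_le_one' (v_symm_dirichletCharacter_le_one ι χ _)
        (v_symm_natCast_zpow_le_one ι q (by omega))
  obtain ⟨N', _, hN', g₀, hnew, hN'eq, hneb, hcoefq, hquad⟩ :=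
    exists_newform_of_congruent_cuspForm ι hL hNL hM hMN (k := (k : ℤ)) (by omega) hχ hGχ b
      (fun q ↦ 1 + χ q * (q : ℂ) ^ ((k : ℤ) - 1)) μ hbT hbU hlamT hμ hbint hb1 hcong
  -- ### Step 8: reading off the conclusions
  have hNN' : N ∣ N' := by
    rcases hN'eq with h | h
    · rw [h]
    · rw [h, hL]; exact dvd_mul_right N M
  have hcondψ : (nebentypus g₀).conductor = N := by
    have h1 := DirichletCharacter.conductor_changeLevel (χ := nebentypus g₀) hN'
    rw [hneb, DirichletCharacter.conductor_changeLevel] at h1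
    rw [← h1]
    exact hχ
  have hpN' : ¬ p ∣ N' := fun h ↦ hpNM (hL ▸ h.trans hN')
  refine ⟨N', ‹_›, g₀, hnew, hpN', ?_, ?_, ?_, ?_⟩
  · -- the level is `cond(χ)` or `cond(χ) M`
    rw [hcondψ]
    rcases hN'eq with h | h
    · exact Or.inl h
    · exact Or.inr (h.trans hL)
  · -- the nebentypus has order prime to `p`
    obtain ⟨m, hm0, hpm, hχm⟩ := horder
    refine ⟨m, hm0, hpm, DirichletCharacter.changeLevel_injective hN' ?_⟩
    rw [map_pow, map_one, hneb, ← map_pow, hχm, map_one]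
  · -- `a_p(g₀) ≡ 1 + χ(p) p^{k-1} ≡ 1`
    have hq := hcoefq p hp (hL ▸ hpNM)
    change Valued.v (ι.symm (cuspCoeff g₀ p) - 1) < 1
    have : ι.symm (cuspCoeff g₀ p) - 1 =
        (ι.symm (cuspCoeff g₀ p) - ι.symm (1 + χ p * (p : ℂ) ^ ((k : ℤ) - 1))) +
          ι.symm (χ p * (p : ℂ) ^ ((k : ℤ) - 1)) := by
      rw [map_add, map_one]; ring
    rw [this]
    refine (Valuation.map_add _ _ _).trans_lt (max_lt hq.2 ?_)
    rw [map_mul, Valuation.map_mul, hzpow p, map_pow, map_natCast ι.symm, Valuation.map_pow]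
    exact mul_lt_one_of_le_one_of_lt_one (v_symm_dirichletCharacter_le_one ι χ _)
      (pow_lt_one₀ zero_le v_natCast_p_lt_one (by omega))
  · -- the congruences at the primes `ℓ ∤ N' p`
    intro ℓ hℓ hℓN' hℓp w hw 𝔓 h𝔓 σ' hσ'
    have hℓN : ¬ ℓ ∣ N := fun h ↦ hℓN' (h.trans hNN')
    set e := ((θ σ' : (PadicAlgCl p)ˣ) : PadicAlgCl p) with he
    by_cases hℓM : ℓ = M
    · -- `ℓ = M`: then `N' = N`, and `a_M(g₀)` comes from `X² - a_M X + χ(M)M^{k-1}`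
      obtain rfl : M = ℓ := hℓM.symm
      have hN'N : N' = N := by
        rcases hN'eq with h | h
        · exact h
        · exact absurd (h ▸ hL ▸ dvd_mul_left M N) hℓN'
      obtain ⟨μ', hμ'int, hμ'cong, hquadμ'⟩ := hquad hN'N
      have heσ := hμFrob w hw 𝔓 h𝔓 σ' hσ'
      have hFℓ := hFrobℓ M hM hMN hMp w hw 𝔓 h𝔓 σ' hσ'
      constructor
      · set A := ι.symm (cuspCoeff g₀ M) with hA
        set m := ι.symm μ' with hm
        set c := ι.symm (χ (M : ZMod N) * (M : ℂ) ^ ((k : ℤ) - 1)) with hc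
        have hquad' : m ^ 2 - A * m + c = 0 := by
          have := congrArg ι.symm hquadμ'
          rw [map_zero, map_add, map_sub, map_pow, map_mul] at this
          exact this
        have hme : Valued.v (m - e) < 1 := by
          have : m - e = (m - ι.symm μ) + (ι.symm μ - e) := by ring
          rw [this]
          exact (Valuation.map_add _ _ _).trans_lt (max_lt hμ'cong heσ)
        have hm1 : Valued.v m = 1 := by
          have : m = (m - e) + e := by ring
          rw [this, Valuation.map_add_eq_of_lt_right, hunit σ']
          rw [hunit σ']
          exact hme
        have hkey : (A - (1 + e)) * m = m * (m - e) + ((c - e) + (e - m)) := by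
          linear_combination (-1 : PadicAlgCl p) * hquad'
        change Valued.v (A - (1 + e)) < 1
        have hmul : Valued.v (A - (1 + e)) = Valued.v ((A - (1 + e)) * m) := by
          rw [Valuation.map_mul, hm1, mul_one]
        rw [hmul, hkey]
        refine (Valuation.map_add _ _ _).trans_lt (max_lt ?_ ?_)
        · rw [Valuation.map_mul, hm1, one_mul]; exact hme
        · refine (Valuation.map_add _ _ _).trans_lt (max_lt hFℓ ?_)
          rw [Valuation.map_sub_swap]; exact hme
      · subst hN'N
        have hψχ : nebentypus g₀ = χ := DirichletCharacter.changeLevel_injective hN' hneb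
        rw [hψχ]
        exact hFℓ
    · -- `ℓ ≠ M`: `ℓ ∤ L`, `a_ℓ(g₀) ≡ 1 + χ(ℓ) ℓ^{k-1}`, `ψ(ℓ) = χ(ℓ)`
      have hℓL : ¬ ℓ ∣ L := by
        rw [hL]
        intro h
        rcases (Nat.Prime.dvd_mul hℓ).1 h with h | h
        · exact hℓN h
        · exact hℓM ((Nat.prime_dvd_prime_iff_eq hℓ hM).1 h)
      have hℓcop : ℓ.Coprime L := (Nat.Prime.coprime_iff_not_dvd hℓ).2 hℓL
      have hq := hcoefq ℓ hℓ hℓL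
      have hFℓ := hFrobℓ ℓ hℓ hℓN hℓp w hw 𝔓 h𝔓 σ' hσ'
      constructor
      · change Valued.v (ι.symm (cuspCoeff g₀ ℓ) - (1 + e)) < 1
        have : ι.symm (cuspCoeff g₀ ℓ) - (1 + e) =
            (ι.symm (cuspCoeff g₀ ℓ) - ι.symm (1 + χ ℓ * (ℓ : ℂ) ^ ((k : ℤ) - 1))) +
              (ι.symm (χ ℓ * (ℓ : ℂ) ^ ((k : ℤ) - 1)) - e) := by
          rw [map_add, map_one]; ring
        rw [this]
        exact (Valuation.map_add _ _ _).trans_lt (max_lt hq.2 hFℓ)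
      · have h1 := changeLevel_apply_natCast_of_coprime hN' (nebentypus g₀) hℓcop
        have h2 := changeLevel_apply_natCast_of_coprime hNL χ hℓcop
        rw [hneb] at h1
        rw [← h1.symm.trans h2] at hFℓ
        exact hFℓ

end Literature.NumberTheory.EllipticCurves
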